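import Summits.BirchSwinnertonDyer.BirchSwinnertonDyer.Theorems.CMKolyvaginAtInertTwoKolyvaginPrimesAtTwo
import HarnessLib

/-!
# CM-inert Kolyvagin primes at `p = 2` in EVERY admissible residue class (prescribed genus type)
# (route CMKolyvaginAtInertTwo; supply for crux `CMKolyvaginConjectureAtInertTwo`, stmt-BirchSwinnertonDyer-24648)

Seat `leafhand-bsd-cmkolyvaginatinert-3` g0 (cell `pub/bsd-eis`); helper (`--supports stmt-BirchSwinnertonDyer-24648
--as helper`). THEOREM-ONLY file (no definition, no named fact, no `sorry`); closes nothing.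

The cell's supply `CMKolyvaginAtInertTwoKolyvaginPrimesAtTwo` (seat `bsd-line-cmk2-p1` g2) uses the ONE class
`ℓ ≡ −1 (mod 2^M·4·|d_K|·|d_F|)` (all such primes are DEEP, `4 ∣ ℓ + 1`); the seat's `…ShallowSupply` (p822010) adds the
class `2D − 1 (mod 4D)` (`ℓ ≡ 1 (mod 4)`). For the genus analysis of the crux's residue (which quadratic twists the genus
points of level `ℓ` see is decided by the classes of `ℓ` modulo the prime divisors of `d_K` and modulo `8`) one wants
Kolyvagin primes of PRESCRIBED type. This file proves the general statement behind both supplies: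

* §1 `isKolyvaginPrime_two_of_discrChar_eq_neg_one` — for `W/ℚ` globally minimal with CM and `K` imaginary quadratic, an
  odd prime `ℓ > N_E` whose classes `[ℓ] ∈ (ℤ/|d_K|)ˣ` and `[ℓ] ∈ (ℤ/|d_F|)ˣ` have `χ_{d_K}([ℓ]) = −1` and `χ_{d_F}([ℓ]) = −1`
  (Cox's characters `χ_D`, tree `Quadratic.discrChar`, Lemma 1.14: `χ_D([ℓ]) = (D/ℓ)`) is a Zhang–Kolyvagin prime at `2`
  for `(W, K)`, inert in the CM field (`CMInert W ℓ`), with `a_ℓ = 0` (Deuring) and `M(ℓ) = v₂(ℓ + 1)`.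
* §2 `exists_isKolyvaginPrime_two_in_class` / `setOf_isKolyvaginPrime_two_in_class_infinite` — for every modulus `m`
  with `|d_K| ∣ m`, `|d_F| ∣ m` and every unit class `u ∈ (ℤ/m)ˣ` whose images have `χ_{d_K} = −1`, `χ_{d_F} = −1`:
  infinitely many primes `ℓ ≡ u (mod m)` beyond any bound, each a CM-inert Zhang–Kolyvagin prime at `2` with `a_ℓ = 0`,
  `M(ℓ) = v₂(ℓ + 1)` (Dirichlet, Mathlib `Nat.forall_exists_prime_gt_and_eq_mod`). Taking `8 ∣ m`, `q ∣ m` for the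
  prime divisors `q` of `d_K`, the class `u` prescribes `ℓ mod 8` (hence the depth `M(ℓ)` when `ℓ ≢ −1 (mod 8)`… and the
  behaviour of `2` in `ℚ(√ℓ*)`) and every `χ_q(ℓ)` — the genus type of `ℓ`.
* §3 `exists_admissible_class` — such classes exist for every admissible modulus: `u = −1` works (`χ_D(−1) = −1` for
  `D < 0`, Cox Ex. 1.12), so §2 is never vacuous; the deep supply of the cell is the instance `u = −1`, the shallow supply of
  p822010 the instance `u = 2|d_K d_F| − 1 (mod 4|d_K d_F|)`.

HONEST FRAMING: Deuring + Dirichlet + Cox's `χ_D`; no stub or item is closed; BSD is proved for no curve; beyond-print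
theorem: no.

References: [cite: Cox2013, §1.C Lemma 1.14 and Exercise 1.12, §5.B Prop. 5.16] [cite: Lang1987, Ch. 13 §4 Thm. 12]
[cite: GrossLMS1991, §3 (3.1)–(3.3)] [cite: WZhang2014, Notations (xii)] ; Dirichlet (Mathlib `PrimesInAP`).
-/

set_option autoImplicit false
set_option linter.dupNamespace false

noncomputable section

open scoped Classical

namespace Summit.BirchSwinnertonDyer.BirchSwinnertonDyer.Theorems.CMKolyvaginPrimes

open WeierstrassCurve NumberField
open Literature.NumberTheory.EllipticCurves
open Literature.NumberTheory.EllipticCurves.Rank1Residual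
open Literature.NumberTheory.QuadraticFields

variable (W : WeierstrassCurve ℚ) [W.IsElliptic] [W.IsGloballyMinimal]

/-! ### §1 A prime in a class of character `−1` for both `d_K` and `d_F` is a CM-inert Kolyvagin prime at `2` -/

/-- **Prescribed-character form of the supply.** `W/ℚ` globally minimal with CM, `K` imaginary quadratic, `ℓ > N_E` an odd
prime whose unit classes modulo `|d_K|` and `|d_F|` have `χ_{d_K}([ℓ]) = −1` and `χ_{d_F}([ℓ]) = −1`: then `ℓ` is a
Zhang–Kolyvagin prime at `2` for `(W, K)` (`ℓ ∤ N_E d_K`, `(ℓ)` inert in `K`, `M(ℓ) > 0`), inert in the CM field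
(`CMInert W ℓ`), `a_ℓ = 0` and `M(ℓ) = v₂(ℓ + 1)`. (`χ_D([ℓ]) = (D/ℓ)`, Cox Lemma 1.14; `(d_K/ℓ) = −1` is inertness,
Cox Prop. 5.16; Deuring.) [cite: Cox2013, §1.C Lemma 1.14, §5.B Prop. 5.16] [cite: Lang1987, Ch. 13 §4 Thm. 12]
[cite: WZhang2014, Notations (xii)] -/
theorem isKolyvaginPrime_two_of_discrChar_eq_neg_one (hCM : W.HasCM) {K : Type} [Field K] [NumberField K]
    (hK : IsImaginaryQuadratic K) {ℓ : ℕ} (hℓ : ℓ.Prime) (hℓ2 : ℓ ≠ 2) (hNℓ : W.conductorNorm ℤ < ℓ)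
    {uK : (ZMod (NumberField.discr K).natAbs)ˣ} (huK : (ℓ : ZMod (NumberField.discr K).natAbs) = uK)
    (hχK : Quadratic.discrChar (NumberField.discr K) uK = -1)
    {uF : (ZMod (cmFieldDiscrOfJ W.j).natAbs)ˣ} (huF : (ℓ : ZMod (cmFieldDiscrOfJ W.j).natAbs) = uF)
    (hχF : Quadratic.discrChar (cmFieldDiscrOfJ W.j) uF = -1) :
    Zhang2014.IsKolyvaginPrime (W.conductorNorm ℤ) W K 2 ℓ ∧ CMInert W ℓ ∧ W.frobeniusTrace ℓ = 0 ∧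
      Zhang2014.kolyvaginIndex W 2 ℓ = padicValNat 2 (ℓ + 1) := by
  haveI := Fact.mk hℓ
  -- `(d_K/ℓ) = −1`
  have hlegK : legendreSym ℓ (NumberField.discr K) = -1 := by
    have h1 := Quadratic.discrChar_natCast_prime hK.discr_neg.ne (Quadratic.discr_emod_four hK.1) hℓ2 huK
    rw [hχK, Units.val_neg, Units.val_one] at h1
    exact h1.symm
  -- `(d_F/ℓ) = −1`
  obtain ⟨hFneg, hF4⟩ := cmFieldDiscrOfJ_neg_and_emod_four W hCM
  have hlegF : legendreSym ℓ (cmFieldDiscrOfJ W.j) = -1 := by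
    have h1 := Quadratic.discrChar_natCast_prime hFneg.ne hF4 hℓ2 huF
    rw [hχF, Units.val_neg, Units.val_one] at h1
    exact h1.symm
  have hdK : ¬ ((ℓ : ℤ) ∣ NumberField.discr K) := not_dvd_of_legendreSym_eq_neg_one hlegK
  have hinert : (Ideal.span {(ℓ : 𝓞 K)}).IsPrime := by
    refine (RingClass.isPrime_span_natCast_iff_jacobiSym_eq_neg_one hK.1 hℓ hℓ2).mpr ?_
    rw [← jacobiSym.legendreSym.to_jacobiSym]
    exact hlegK
  have hcm : CMInert W ℓ := by
    refine ⟨not_dvd_of_legendreSym_eq_neg_one hlegF, ?_⟩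
    rintro ⟨-, hsq⟩
    rw [if_neg hℓ2] at hsq
    exact (legendreSym.eq_neg_one_iff ℓ).mp hlegF hsq
  have hNdvd : ¬ ℓ ∣ W.conductorNorm ℤ := fun hd ↦
    absurd (Nat.le_of_dvd W.conductorNorm_pos_holds hd) (not_le.mpr hNℓ)
  have hgood : W.HasGoodReductionAtPrime ℓ := by
    by_contra hbad
    exact hNdvd ((dvd_conductorNorm_iff_not_hasGoodReductionAtPrime (W := W) ℓ).mpr hbad)
  have ha : W.frobeniusTrace ℓ = 0 :=
    Summit.BirchSwinnertonDyer.Rank1Residual.frobeniusTrace_eq_zero_of_hasCM_of_cmInert hCM hℓ2 hgood hcm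
  have hidx := kolyvaginIndex_two_eq_of_frobeniusTrace_eq_zero W ha
  refine ⟨⟨hℓ, hNdvd, hdK, hℓ2, hinert, ?_⟩, hcm, ha, hidx⟩
  rw [hidx]
  haveI : Fact (Nat.Prime 2) := ⟨Nat.prime_two⟩
  have h2 : 2 ∣ ℓ + 1 := by
    obtain ⟨r, hr⟩ := hℓ.odd_of_ne_two hℓ2
    omega
  exact one_le_padicValNat_of_dvd (by omega) h2

/-! ### §2 Dirichlet: every admissible class carries infinitely many CM-inert Kolyvagin primes at `2` -/

/-- **CM-inert Kolyvagin primes at `2` in a prescribed class.** `W/ℚ` globally minimal with CM, `K` imaginary quadratic,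
`m` a modulus divisible by `|d_K|` and `|d_F|`, `u ∈ (ℤ/m)ˣ` a class whose images have `χ_{d_K} = −1` and `χ_{d_F} = −1`:
for every `n` there is a prime `ℓ > n` with `ℓ ≡ u (mod m)` which is a Zhang–Kolyvagin prime at `2` for `(W, K)`, inert in the
CM field, with `a_ℓ = 0` and `M(ℓ) = v₂(ℓ + 1)`. [cite: Cox2013, §1.C Lemma 1.14, §5.B Prop. 5.16]
[cite: Lang1987, Ch. 13 §4 Thm. 12] [cite: WZhang2014, Notations (xii)] -/
theorem exists_isKolyvaginPrime_two_in_class (hCM : W.HasCM) {K : Type} [Field K] [NumberField K]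
    (hK : IsImaginaryQuadratic K) {m : ℕ} [NeZero m] (hmK : (NumberField.discr K).natAbs ∣ m)
    (hmF : (cmFieldDiscrOfJ W.j).natAbs ∣ m) (u : (ZMod m)ˣ)
    (hχK : Quadratic.discrChar (NumberField.discr K) (ZMod.unitsMap hmK u) = -1)
    (hχF : Quadratic.discrChar (cmFieldDiscrOfJ W.j) (ZMod.unitsMap hmF u) = -1) (n : ℕ) :
    ∃ ℓ : ℕ, n < ℓ ∧ (ℓ : ZMod m) = u ∧ Zhang2014.IsKolyvaginPrime (W.conductorNorm ℤ) W K 2 ℓ ∧ CMInert W ℓ ∧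
      W.frobeniusTrace ℓ = 0 ∧ Zhang2014.kolyvaginIndex W 2 ℓ = padicValNat 2 (ℓ + 1) := by
  obtain ⟨ℓ, hℓgt, hℓ, hℓm⟩ :=
    Nat.forall_exists_prime_gt_and_eq_mod (Units.isUnit u) (max n (max (W.conductorNorm ℤ) 2))
  simp only [gt_iff_lt, max_lt_iff] at hℓgt
  have hℓ2 : ℓ ≠ 2 := by omega
  have huK : (ℓ : ZMod (NumberField.discr K).natAbs) = (ZMod.unitsMap hmK u : ZMod (NumberField.discr K).natAbs) := by
    rw [ZMod.unitsMap_val, ← hℓm, ZMod.cast_natCast hmK]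
  have huF : (ℓ : ZMod (cmFieldDiscrOfJ W.j).natAbs) =
      (ZMod.unitsMap hmF u : ZMod (cmFieldDiscrOfJ W.j).natAbs) := by
    rw [ZMod.unitsMap_val, ← hℓm, ZMod.cast_natCast hmF]
  exact ⟨ℓ, hℓgt.1, hℓm,
    isKolyvaginPrime_two_of_discrChar_eq_neg_one W hCM hK hℓ hℓ2 hℓgt.2.1 huK hχK huF hχF⟩

/-- **The set of CM-inert Kolyvagin primes at `2` in a prescribed admissible class is infinite** (same content,
`Set.Infinite` form). [cite: Cox2013, §5.B Prop. 5.16] [cite: Lang1987, Ch. 13 §4 Thm. 12] -/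
theorem setOf_isKolyvaginPrime_two_in_class_infinite (hCM : W.HasCM) {K : Type} [Field K] [NumberField K]
    (hK : IsImaginaryQuadratic K) {m : ℕ} [NeZero m] (hmK : (NumberField.discr K).natAbs ∣ m)
    (hmF : (cmFieldDiscrOfJ W.j).natAbs ∣ m) (u : (ZMod m)ˣ)
    (hχK : Quadratic.discrChar (NumberField.discr K) (ZMod.unitsMap hmK u) = -1)
    (hχF : Quadratic.discrChar (cmFieldDiscrOfJ W.j) (ZMod.unitsMap hmF u) = -1) :
    {ℓ : ℕ | (ℓ : ZMod m) = u ∧ Zhang2014.IsKolyvaginPrime (W.conductorNorm ℤ) W K 2 ℓ ∧ CMInert W ℓ}.Infinite := by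
  refine Set.infinite_of_forall_exists_gt fun n ↦ ?_
  obtain ⟨ℓ, hn, hℓm, hKol, hcm, -, -⟩ := exists_isKolyvaginPrime_two_in_class W hCM hK hmK hmF u hχK hχF n
  exact ⟨ℓ, ⟨hℓm, hKol, hcm⟩, hn⟩

/-! ### §3 Admissible classes exist for every admissible modulus -/

/-- Reduction of units maps `−1` to `−1`. [folklore] -/
theorem unitsMap_neg_one {m d : ℕ} (hd : d ∣ m) : ZMod.unitsMap hd (-1) = -1 := by
  ext
  rw [ZMod.unitsMap_val, Units.val_neg, Units.val_one, Units.val_neg, Units.val_one, ZMod.cast_neg hd,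
    ZMod.cast_one hd]

omit [W.IsGloballyMinimal] in
/-- **The class `−1` is admissible**: for `W` with CM and `K` imaginary quadratic and any modulus `m` divisible by `|d_K|`
and `|d_F|`, the unit `−1 ∈ (ℤ/m)ˣ` has `χ_{d_K}(−1) = −1` and `χ_{d_F}(−1) = −1` (both discriminants are negative;
Cox Ex. 1.12). Hence §2 is never vacuous (this recovers the cell's deep supply). [cite: Cox2013, §1.C Exercise 1.12] -/
theorem exists_admissible_class (hCM : W.HasCM) {K : Type} [Field K] [NumberField K]
    (hK : IsImaginaryQuadratic K) {m : ℕ} (hmK : (NumberField.discr K).natAbs ∣ m)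
    (hmF : (cmFieldDiscrOfJ W.j).natAbs ∣ m) :
    Quadratic.discrChar (NumberField.discr K) (ZMod.unitsMap hmK (-1)) = -1 ∧
      Quadratic.discrChar (cmFieldDiscrOfJ W.j) (ZMod.unitsMap hmF (-1)) = -1 := by
  obtain ⟨hFneg, hF4⟩ := cmFieldDiscrOfJ_neg_and_emod_four W hCM
  rw [unitsMap_neg_one, unitsMap_neg_one]
  exact ⟨Quadratic.discrChar_neg_one hK.discr_neg (Quadratic.discr_emod_four hK.1),
    Quadratic.discrChar_neg_one hFneg hF4⟩

/-- **Corollary: CM-inert Kolyvagin primes at `2` with prescribed class modulo ANY auxiliary modulus coprime to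
`d_K d_F`.** For `W` with CM, `K` imaginary quadratic, `m₀` coprime to `|d_K|·|d_F|` and any unit class `u₀ ∈ (ℤ/m₀)ˣ`:
beyond every bound there is a CM-inert Zhang–Kolyvagin prime `ℓ` at `2` with `ℓ ≡ u₀ (mod m₀)` (and `ℓ ≡ −1` modulo
`|d_K|·|d_F|`), `a_ℓ = 0`, `M(ℓ) = v₂(ℓ + 1)` — Chinese remainder on `(ℤ/(m₀·|d_K d_F|))ˣ ≃ (ℤ/m₀)ˣ × (ℤ/|d_K d_F|)ˣ` with the
admissible class `−1` on the second factor. E.g. `m₀ = 8`, `u₀ = 1, 5` gives shallow primes (`M(ℓ) = 1`) with `2` split,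
resp. inert, in `ℚ(√ℓ)`; `u₀ = 3` gives `M(ℓ) = 2` exactly — when `d_K d_F` is odd.
[cite: Cox2013, §1.C Exercise 1.12, §5.B Prop. 5.16] [cite: WZhang2014, Notations (xii)] -/
theorem exists_isKolyvaginPrime_two_mod_coprime (hCM : W.HasCM) {K : Type} [Field K] [NumberField K]
    (hK : IsImaginaryQuadratic K) {m₀ : ℕ} [NeZero m₀]
    (hcop : m₀.Coprime ((NumberField.discr K).natAbs * (cmFieldDiscrOfJ W.j).natAbs)) (u₀ : (ZMod m₀)ˣ) (n : ℕ) :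
    ∃ ℓ : ℕ, n < ℓ ∧ (ℓ : ZMod m₀) = u₀ ∧
      (ℓ : ZMod ((NumberField.discr K).natAbs * (cmFieldDiscrOfJ W.j).natAbs)) = -1 ∧
      Zhang2014.IsKolyvaginPrime (W.conductorNorm ℤ) W K 2 ℓ ∧ CMInert W ℓ ∧
      W.frobeniusTrace ℓ = 0 ∧ Zhang2014.kolyvaginIndex W 2 ℓ = padicValNat 2 (ℓ + 1) := by
  set D : ℕ := (NumberField.discr K).natAbs * (cmFieldDiscrOfJ W.j).natAbs with hD_def
  have hDK0 : (NumberField.discr K).natAbs ≠ 0 := Int.natAbs_ne_zero.mpr (NumberField.discr_ne_zero K)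
  have hDF0 : (cmFieldDiscrOfJ W.j).natAbs ≠ 0 :=
    Int.natAbs_ne_zero.mpr (cmFieldDiscrOfJ_neg_and_emod_four W hCM).1.ne
  have hD0 : D ≠ 0 := mul_ne_zero hDK0 hDF0
  haveI : NeZero D := ⟨hD0⟩
  haveI : NeZero (m₀ * D) := ⟨mul_ne_zero (NeZero.ne m₀) hD0⟩
  -- the CRT class: `u₀` mod `m₀`, `−1` mod `D`
  let e : ZMod (m₀ * D) ≃+* ZMod m₀ × ZMod D := ZMod.chineseRemainder hcop
  let x : ZMod (m₀ * D) := e.symm ((u₀ : ZMod m₀), -1)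
  have hx : e x = ((u₀ : ZMod m₀), -1) := e.apply_symm_apply _
  have hx1 : (ZMod.castHom (dvd_mul_right m₀ D) (ZMod m₀)) x = (u₀ : ZMod m₀) := by
    have := congrArg Prod.fst hx
    simpa [e, ZMod.chineseRemainder] using this
  have hx2 : (ZMod.castHom (dvd_mul_left D m₀) (ZMod D)) x = -1 := by
    have := congrArg Prod.snd hx
    simpa [e, ZMod.chineseRemainder] using this
  have hxu : IsUnit x := by
    rw [← isUnit_map_iff e, hx, Prod.isUnit_iff]
    exact ⟨Units.isUnit u₀, isUnit_one.neg⟩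
  have hmK : (NumberField.discr K).natAbs ∣ m₀ * D := dvd_trans (dvd_mul_right _ _) (dvd_mul_left D m₀)
  have hmF : (cmFieldDiscrOfJ W.j).natAbs ∣ m₀ * D := dvd_trans (dvd_mul_left _ _) (dvd_mul_left D m₀)
  -- images of the class in `(ℤ/|d_K|)ˣ`, `(ℤ/|d_F|)ˣ` are `−1`
  have hK1 : ZMod.unitsMap hmK hxu.unit = -1 := by
    have hcomp : ZMod.castHom hmK (ZMod (NumberField.discr K).natAbs) =
        (ZMod.castHom (dvd_mul_right _ (cmFieldDiscrOfJ W.j).natAbs) (ZMod (NumberField.discr K).natAbs)).comp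
          (ZMod.castHom (dvd_mul_left D m₀) (ZMod D)) := RingHom.ext_zmod _ _
    ext
    rw [ZMod.unitsMap_val, IsUnit.unit_spec, Units.val_neg, Units.val_one,
      ← ZMod.castHom_apply (R := ZMod (NumberField.discr K).natAbs) (h := hmK), hcomp, RingHom.comp_apply, hx2,
      map_neg, map_one]
  have hF1 : ZMod.unitsMap hmF hxu.unit = -1 := by
    have hcomp : ZMod.castHom hmF (ZMod (cmFieldDiscrOfJ W.j).natAbs) =
        (ZMod.castHom (dvd_mul_left _ (NumberField.discr K).natAbs) (ZMod (cmFieldDiscrOfJ W.j).natAbs)).comp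
          (ZMod.castHom (dvd_mul_left D m₀) (ZMod D)) := RingHom.ext_zmod _ _
    ext
    rw [ZMod.unitsMap_val, IsUnit.unit_spec, Units.val_neg, Units.val_one,
      ← ZMod.castHom_apply (R := ZMod (cmFieldDiscrOfJ W.j).natAbs) (h := hmF), hcomp, RingHom.comp_apply, hx2,
      map_neg, map_one]
  obtain ⟨hFneg, hF4⟩ := cmFieldDiscrOfJ_neg_and_emod_four W hCM
  have hχK : Quadratic.discrChar (NumberField.discr K) (ZMod.unitsMap hmK hxu.unit) = -1 := by
    rw [hK1]
    exact Quadratic.discrChar_neg_one hK.discr_neg (Quadratic.discr_emod_four hK.1)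
  have hχF : Quadratic.discrChar (cmFieldDiscrOfJ W.j) (ZMod.unitsMap hmF hxu.unit) = -1 := by
    rw [hF1]
    exact Quadratic.discrChar_neg_one hFneg hF4
  obtain ⟨ℓ, hn, hℓx, hKol, hcm, ha, hidx⟩ :=
    exists_isKolyvaginPrime_two_in_class W hCM hK hmK hmF hxu.unit hχK hχF n
  rw [IsUnit.unit_spec] at hℓx
  refine ⟨ℓ, hn, ?_, ?_, hKol, hcm, ha, hidx⟩
  · have h := congrArg (ZMod.castHom (dvd_mul_right m₀ D) (ZMod m₀)) hℓx
    rw [map_natCast, hx1] at h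
    exact h
  · have h := congrArg (ZMod.castHom (dvd_mul_left D m₀) (ZMod D)) hℓx
    rw [map_natCast, hx2] at h
    exact h

end Summit.BirchSwinnertonDyer.BirchSwinnertonDyer.Theorems.CMKolyvaginPrimes

end
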